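import Literature.AnabelianGeometry.SemiGraphs.ArithmeticCoverings

/-!
# The category of connected arithmetic semi-graphs of anabelioids ([SemiAnbd] §5, Def 5.1 (iv))

Mochizuki, *Semi-graphs of anabelioids*, Publ. RIMS **42** (2006), §5 p.63 of the author's
manuscript (kurims `paper:url-f33ace170ff4`). [cite: MochizukiSemiAnbd2006, Def 5.1 (iv), p. 63]

Definition 5.1 (iv) defines a morphism `𝔊' → 𝔊` of connected arithmetic semi-graphs of anabelioids
as a compatible pair `(π̂₁(A') → π̂₁(A), 𝔾' → 𝔾)` "which we regard up to composition with the inner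
action of `π̂₁(A)` on `(𝔾, ρ_𝔾)`", and then freely composes such morphisms ("tempered covering of
`𝔊`", "BC-finite étale coverings `ℌ' → ℌ`", Prop 5.2).  This presupposes — a claim made in passing —
that "up to the inner action" is an equivalence relation on representatives (`ArithHom`,
`ArithHom.InnerEquiv` of `Arithmetic.lean`) which is moreover a congruence for composition of
representatives (`ArithHom.comp` of `ArithmeticCoverings.lean`).  This file PROVES that bookkeeping
and assembles the resulting honest category:

* `ArithHom.ext'`; `ArithHom.id_comp'`, `comp_id'`, `comp_assoc'` (strict laws on representatives);
* `InnerEquiv.symm`, `InnerEquiv.trans` (with `InnerEquiv.refl` of `Arithmetic.lean`: an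
  equivalence relation), `ArithHom.innerSetoid`;
* `InnerEquiv.comp_left`, `InnerEquiv.comp_right`, `InnerEquiv.comp` (congruence; the key input
  is the compatibility field `ArithHom.compat`: `ρ'(a') ≫ f = f ≫ ρ(α a')`);
* invariance under inner equivalence of the arithmetic-component classes of Def 5.1 (iv)
  (`IsArithIso`, `IsArithFiniteEtale`, `IsLocallyOpen`) and of "the geometric component is an
  isomorphism", hence of `IsBCFiniteEtale` and `IsIsomorphism`;
* `instance : Category (ArithSemiGraph 𝓥)` — objects: connected arithmetic semi-graphs of
  anabelioids over the ambient interface `𝓥` (Def 5.1 (ii)); arrows: inner-equivalence classes of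
  representatives (`Quotient`), composition induced by `ArithHom.comp`.

As in `Arithmetic.lean`, the geometric component of a representative is an arrow of the ambient
1-category of the interface (the locally open case; TODO(general form) recorded there).  Nothing
in this file asserts a result of the paper beyond this bookkeeping; no side is taken on anything.
-/

namespace Literature.AnabelianGeometry.SemiGraphs

open _root_.CategoryTheory

universe u v w

variable {Obj : Type u} [Category.{v} Obj] {𝓥 : SemiAnbdVocab.{u, v, w} Obj}

namespace ArithHom

variable {𝔊₁ 𝔊₂ 𝔊₃ 𝔊₄ : ArithSemiGraph 𝓥}

/-- Two representatives with the same arithmetic and geometric components are equal (the other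
fields are propositions). [cite: MochizukiSemiAnbd2006, Def 5.1 (iv), p. 63] -/
theorem ext' {φ ψ : ArithHom 𝓥 𝔊₁ 𝔊₂} (h₁ : φ.arith = ψ.arith) (h₂ : φ.geom = ψ.geom) : φ = ψ := by
  cases φ; cases ψ; cases h₁; cases h₂; rfl

/-- In `Aut G`, `(ρ a).hom ≫ (ρ b).hom = (ρ (b * a)).hom` for a homomorphism `ρ` (Mathlib's group
law on `Aut` is reversed composition). [cite: MochizukiSemiAnbd2006, Def 5.1 (i), p. 62] -/
theorem rho_hom_comp_rho_hom (𝔊 : ArithSemiGraph 𝓥) (a b : 𝔊.PA) :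
    (𝔊.ρ a).hom ≫ (𝔊.ρ b).hom = (𝔊.ρ (b * a)).hom := by
  rw [map_mul]; rfl

/-- `(ρ 1).hom` is the identity. [cite: MochizukiSemiAnbd2006, Def 5.1 (i), p. 62] -/
theorem rho_one_hom (𝔊 : ArithSemiGraph 𝓥) : (𝔊.ρ 1).hom = 𝟙 𝔊.G := by
  rw [map_one]; rfl

/-! ### Strict laws on representatives -/

/-- Left unit law for composition of representatives. [cite: MochizukiSemiAnbd2006, Def 5.1 (iv), p. 63] -/
theorem id_comp' (φ : ArithHom 𝓥 𝔊₁ 𝔊₂) : (ArithHom.id 𝔊₁).comp φ = φ :=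
  ext' (by simp [comp, ArithHom.id]) (by simp [comp, ArithHom.id])

/-- Right unit law for composition of representatives. [cite: MochizukiSemiAnbd2006, Def 5.1 (iv), p. 63] -/
theorem comp_id' (φ : ArithHom 𝓥 𝔊₁ 𝔊₂) : φ.comp (ArithHom.id 𝔊₂) = φ :=
  ext' (by simp [comp, ArithHom.id]) (by simp [comp, ArithHom.id])

/-- Associativity of composition of representatives. [cite: MochizukiSemiAnbd2006, Def 5.1 (iv), p. 63] -/
theorem comp_assoc' (φ : ArithHom 𝓥 𝔊₁ 𝔊₂) (ψ : ArithHom 𝓥 𝔊₂ 𝔊₃) (χ : ArithHom 𝓥 𝔊₃ 𝔊₄) :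
    (φ.comp ψ).comp χ = φ.comp (ψ.comp χ) :=
  ext' (by simp [comp, MonoidHom.comp_assoc]) (by simp [comp])

/-! ### "Up to composition with the inner action" is an equivalence relation -/

/-- Inner equivalence is symmetric (witness `a⁻¹`). [cite: MochizukiSemiAnbd2006, Def 5.1 (iv), p. 63] -/
theorem InnerEquiv.symm {φ ψ : ArithHom 𝓥 𝔊₁ 𝔊₂} (h : InnerEquiv φ ψ) : InnerEquiv ψ φ := by
  obtain ⟨a, ha, hg⟩ := h
  refine ⟨a⁻¹, fun a' => ?_, ?_⟩
  · rw [ha a', inv_inv]; group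
  · rw [hg, Category.assoc, rho_hom_comp_rho_hom, inv_mul_cancel, rho_one_hom, Category.comp_id]

/-- Inner equivalence is transitive (witness `b * a`). [cite: MochizukiSemiAnbd2006, Def 5.1 (iv), p. 63] -/
theorem InnerEquiv.trans {φ ψ χ : ArithHom 𝓥 𝔊₁ 𝔊₂} (h₁ : InnerEquiv φ ψ) (h₂ : InnerEquiv ψ χ) :
    InnerEquiv φ χ := by
  obtain ⟨a, ha, hga⟩ := h₁
  obtain ⟨b, hb, hgb⟩ := h₂
  refine ⟨b * a, fun a' => ?_, ?_⟩
  · rw [hb a', ha a']; group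
  · rw [hgb, hga, Category.assoc, rho_hom_comp_rho_hom]

/-- Inner equivalence is an equivalence relation on representatives `𝔊₁ → 𝔊₂`.
[cite: MochizukiSemiAnbd2006, Def 5.1 (iv), p. 63] -/
theorem InnerEquiv.equivalence : Equivalence (@InnerEquiv _ _ 𝓥 𝔊₁ 𝔊₂) :=
  ⟨InnerEquiv.refl, InnerEquiv.symm, InnerEquiv.trans⟩

variable (𝔊₁ 𝔊₂) in
/-- The setoid "regarded up to composition with the inner action of `π̂₁(A)`" on representatives of
morphisms `𝔊₁ → 𝔊₂`. [cite: MochizukiSemiAnbd2006, Def 5.1 (iv), p. 63] -/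
def innerSetoid : Setoid (ArithHom 𝓥 𝔊₁ 𝔊₂) := ⟨InnerEquiv, InnerEquiv.equivalence⟩

/-! ### Congruence for composition -/

/-- Changing the FIRST factor within its inner-equivalence class changes the composite within its
class: the witness `a ∈ π̂₁(A₂)` is carried to `ψ(a) ∈ π̂₁(A₃)` by the compatibility
`ρ₂(a) ≫ ψ = ψ ≫ ρ₃(ψ a)` of `ψ`. [cite: MochizukiSemiAnbd2006, Def 5.1 (iv), p. 63] -/
theorem InnerEquiv.comp_left {φ φ' : ArithHom 𝓥 𝔊₁ 𝔊₂} (h : InnerEquiv φ φ') (ψ : ArithHom 𝓥 𝔊₂ 𝔊₃) :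
    InnerEquiv (φ.comp ψ) (φ'.comp ψ) := by
  obtain ⟨a, ha, hg⟩ := h
  refine ⟨ψ.arith a, fun a' => ?_, ?_⟩
  · simp only [comp, MonoidHom.comp_apply, ha a', map_mul, map_inv]
  · simp only [comp, hg, Category.assoc, ψ.compat a]

/-- Changing the SECOND factor within its inner-equivalence class changes the composite within its
class (same witness). [cite: MochizukiSemiAnbd2006, Def 5.1 (iv), p. 63] -/
theorem InnerEquiv.comp_right (φ : ArithHom 𝓥 𝔊₁ 𝔊₂) {ψ ψ' : ArithHom 𝓥 𝔊₂ 𝔊₃} (h : InnerEquiv ψ ψ') :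
    InnerEquiv (φ.comp ψ) (φ.comp ψ') := by
  obtain ⟨b, hb, hg⟩ := h
  refine ⟨b, fun a' => ?_, ?_⟩
  · simp only [comp, MonoidHom.comp_apply, hb]
  · simp only [comp, hg, Category.assoc]

/-- Inner equivalence is a congruence for composition of representatives.
[cite: MochizukiSemiAnbd2006, Def 5.1 (iv), p. 63] -/
theorem InnerEquiv.comp {φ φ' : ArithHom 𝓥 𝔊₁ 𝔊₂} {ψ ψ' : ArithHom 𝓥 𝔊₂ 𝔊₃} (hφ : InnerEquiv φ φ')
    (hψ : InnerEquiv ψ ψ') : InnerEquiv (φ.comp ψ) (φ'.comp ψ') :=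
  (hφ.comp_left ψ).trans (InnerEquiv.comp_right φ' hψ)

/-! ### The classes of morphisms of Def 5.1 (iv) do not depend on the representative -/

section Conj

variable {P : Type*} [Group P] [TopologicalSpace P] [IsTopologicalGroup P]

/-- Conjugation `x ↦ a x a⁻¹` as a homeomorphism of a topological group (bookkeeping for the
invariance lemmas below). [cite: MochizukiSemiAnbd2006, Def 5.1 (iv), p. 63] -/
def conjHomeo (a : P) : P ≃ₜ P := (Homeomorph.mulLeft a).trans (Homeomorph.mulRight a⁻¹)

/-- `conjHomeo a` is `MulAut.conj a` on elements. [cite: MochizukiSemiAnbd2006, Def 5.1 (iv), p. 63] -/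
@[simp] theorem conjHomeo_apply (a x : P) : conjHomeo a x = a * x * a⁻¹ := rfl

end Conj

/-- The arithmetic components of inner-equivalent representatives differ by a conjugation.
[cite: MochizukiSemiAnbd2006, Def 5.1 (iv), p. 63] -/
theorem InnerEquiv.coe_arith_eq {φ ψ : ArithHom 𝓥 𝔊₁ 𝔊₂} (h : InnerEquiv φ ψ) :
    ∃ a : 𝔊₂.PA, ⇑ψ.arith = conjHomeo a ∘ ⇑φ.arith := by
  obtain ⟨a, ha, -⟩ := h
  exact ⟨a, funext fun a' => by simp [ha a']⟩

/-- Conjugate homomorphisms are simultaneously bijective. [cite: MochizukiSemiAnbd2006, Def 5.1 (iv), p. 63] -/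
theorem InnerEquiv.isArithIso_iff {φ ψ : ArithHom 𝓥 𝔊₁ 𝔊₂} (h : InnerEquiv φ ψ) :
    φ.IsArithIso ↔ ψ.IsArithIso := by
  obtain ⟨a, key⟩ := h.coe_arith_eq
  unfold IsArithIso
  rw [key]
  exact ((conjHomeo a).bijective.of_comp_iff' _).symm

/-- Conjugate homomorphisms are simultaneously injective with open image.
[cite: MochizukiSemiAnbd2006, Def 5.1 (iv), p. 63] -/
theorem InnerEquiv.isArithFiniteEtale_iff {φ ψ : ArithHom 𝓥 𝔊₁ 𝔊₂} (h : InnerEquiv φ ψ) :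
    φ.IsArithFiniteEtale ↔ ψ.IsArithFiniteEtale := by
  obtain ⟨a, key⟩ := h.coe_arith_eq
  unfold IsArithFiniteEtale
  rw [key, Set.range_comp, (conjHomeo a).isOpen_image]
  exact and_congr ((conjHomeo a).injective.of_comp_iff _).symm Iff.rfl

/-- Conjugate homomorphisms simultaneously have open image ("locally open" arithmetic component).
[cite: MochizukiSemiAnbd2006, Def 5.1 (iv), p. 63] -/
theorem InnerEquiv.isLocallyOpen_iff {φ ψ : ArithHom 𝓥 𝔊₁ 𝔊₂} (h : InnerEquiv φ ψ) :
    φ.IsLocallyOpen ↔ ψ.IsLocallyOpen := by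
  obtain ⟨a, key⟩ := h.coe_arith_eq
  unfold IsLocallyOpen
  rw [key, Set.range_comp, (conjHomeo a).isOpen_image]

/-- Inner-equivalent representatives simultaneously have an isomorphism as geometric component
(they differ by the automorphism `ρ(a)`). [cite: MochizukiSemiAnbd2006, Def 5.1 (iv), p. 63] -/
theorem InnerEquiv.isIso_geom_iff {φ ψ : ArithHom 𝓥 𝔊₁ 𝔊₂} (h : InnerEquiv φ ψ) :
    IsIso φ.geom ↔ IsIso ψ.geom := by
  obtain ⟨a, -, hg⟩ := h
  rw [hg]
  constructor
  · intro; infer_instance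
  · intro hi; exact IsIso.of_isIso_comp_right φ.geom (𝔊₂.ρ a).hom

/-- "BC-finite étale" does not depend on the representative. [cite: MochizukiSemiAnbd2006, Def 5.1 (iv), p. 63] -/
theorem InnerEquiv.isBCFiniteEtale_iff {φ ψ : ArithHom 𝓥 𝔊₁ 𝔊₂} (h : InnerEquiv φ ψ) :
    φ.IsBCFiniteEtale ↔ ψ.IsBCFiniteEtale :=
  and_congr h.isIso_geom_iff h.isArithFiniteEtale_iff

/-- "Isomorphism" does not depend on the representative. [cite: MochizukiSemiAnbd2006, Def 5.1 (iv), p. 63] -/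
theorem InnerEquiv.isIsomorphism_iff {φ ψ : ArithHom 𝓥 𝔊₁ 𝔊₂} (h : InnerEquiv φ ψ) :
    φ.IsIsomorphism ↔ ψ.IsIsomorphism :=
  and_congr h.isIso_geom_iff h.isArithIso_iff

end ArithHom

/-! ### The category -/

namespace ArithSemiGraph

/-- **Def 5.1 (iv)**, the category of connected arithmetic semi-graphs of anabelioids over the
ambient interface: arrows `𝔊₁ ⟶ 𝔊₂` are representatives `ArithHom 𝓥 𝔊₁ 𝔊₂` "regarded up to
composition with the inner action of `π̂₁(A₂)`" (a `Quotient` by `ArithHom.innerSetoid`), composed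
via `ArithHom.comp` (well defined by `InnerEquiv.comp`). [cite: MochizukiSemiAnbd2006, Def 5.1 (iv), p. 63] -/
instance instCategory : Category (ArithSemiGraph 𝓥) where
  Hom 𝔊₁ 𝔊₂ := Quotient (ArithHom.innerSetoid 𝔊₁ 𝔊₂)
  id 𝔊 := Quotient.mk _ (ArithHom.id 𝔊)
  comp f g := Quotient.map₂ ArithHom.comp (fun _ _ hφ _ _ hψ => ArithHom.InnerEquiv.comp hφ hψ) f g
  id_comp f := by
    induction f using Quotient.ind with
    | _ φ => exact congrArg (Quotient.mk _) (ArithHom.id_comp' φ)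
  comp_id f := by
    induction f using Quotient.ind with
    | _ φ => exact congrArg (Quotient.mk _) (ArithHom.comp_id' φ)
  assoc f g h := by
    induction f using Quotient.ind with
    | _ φ =>
      induction g using Quotient.ind with
      | _ ψ =>
        induction h using Quotient.ind with
        | _ χ => exact congrArg (Quotient.mk _) (ArithHom.comp_assoc' φ ψ χ)

/-- The class of a representative, as an arrow of the category. [cite: MochizukiSemiAnbd2006, Def 5.1 (iv), p. 63] -/
def homMk {𝔊₁ 𝔊₂ : ArithSemiGraph 𝓥} (φ : ArithHom 𝓥 𝔊₁ 𝔊₂) : 𝔊₁ ⟶ 𝔊₂ :=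
  Quotient.mk (ArithHom.innerSetoid 𝔊₁ 𝔊₂) φ

/-- Every arrow has a representative. [cite: MochizukiSemiAnbd2006, Def 5.1 (iv), p. 63] -/
theorem homMk_surjective {𝔊₁ 𝔊₂ : ArithSemiGraph 𝓥} :
    Function.Surjective (homMk : ArithHom 𝓥 𝔊₁ 𝔊₂ → (𝔊₁ ⟶ 𝔊₂)) :=
  Quotient.mk_surjective

/-- Two representatives define the same arrow iff they are inner equivalent.
[cite: MochizukiSemiAnbd2006, Def 5.1 (iv), p. 63] -/
theorem homMk_eq_homMk_iff {𝔊₁ 𝔊₂ : ArithSemiGraph 𝓥} (φ ψ : ArithHom 𝓥 𝔊₁ 𝔊₂) :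
    homMk φ = homMk ψ ↔ ArithHom.InnerEquiv φ ψ :=
  Quotient.eq (r := ArithHom.innerSetoid 𝔊₁ 𝔊₂)

/-- Composition of classes is the class of the composite of representatives.
[cite: MochizukiSemiAnbd2006, Def 5.1 (iv), p. 63] -/
@[simp] theorem homMk_comp_homMk {𝔊₁ 𝔊₂ 𝔊₃ : ArithSemiGraph 𝓥} (φ : ArithHom 𝓥 𝔊₁ 𝔊₂)
    (ψ : ArithHom 𝓥 𝔊₂ 𝔊₃) : homMk φ ≫ homMk ψ = homMk (φ.comp ψ) := rfl

/-- The identity arrow is the class of the identity representative.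
[cite: MochizukiSemiAnbd2006, Def 5.1 (iv), p. 63] -/
@[simp] theorem homMk_id (𝔊 : ArithSemiGraph 𝓥) : homMk (ArithHom.id 𝔊) = 𝟙 𝔊 := rfl

end ArithSemiGraph

end Literature.AnabelianGeometry.SemiGraphs
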